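import Mathlib

/-!
# Venture HSemireg — THEOREM K∘T for the box (1/8)

HONEST FRAMING. Part of the Lean index of the computation cell `pub-hsemireg` (seat p3; Sunday enclosure of the
FORMULA-N kernel assets of seats th-7 / th-6, ENCLOSURE-PLAN-p3.md).  Finite-dimensional exterior algebra over a field ONLY:
no variety, no cohomology theory, no semiregularity map is constructed here; nothing here says that HC / HC_CM / HC_AV holds;
no Literature fact is declared or used.  The geometric DICTIONARY (why these ranks are the `HT`-side box ranks of the cell's
STRUCTURE.md §1 / theory/FORMULA-N.md) lives in theory/FORMULA-N-th7.md PART B §A.3 / §N and is NOT asserted in Lean.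

THEOREM K∘T for the BOX of two point pairs (FORMULA-N PART A §2.3 / PART B §L; th-7 theory/th7/BoxRank.lean v4 sha256/16
88aeb4a1de514ae6, l.36–299), file 1 of 8 — generators `I n := Fin (4n)` in four blocks `A 0 = X`, `A 1 = Y` (factor 1), `C 0 = X′`,
`C 1 = Y′` (factor 2); the coefficient-matrix box `boxClass c := Σ_{α,β} c α β • E_{A α ∪ C β}` and the HONEST box `fac1 a * fac2 a′`;
ranks of `θ ↦ θ ∧ box` on `⋀^k` in every degree: `4C(2n,k) − 4C(n,k)` (0 < k < n), the degree-n PURITY DROP `4C(2n,n) − 6` on the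
decomposable locus, `4C(2n,k) − 4C(n,k−n)` (n < k < 2n), `1` in degrees 0 and 2n; one citable form `finrank_range_wedgeMap_fac_mul_all`
(file 8).  No permutation sign is ever evaluated.  th-7's statements and proofs, unchanged (namespace `HSemiregBox` ↦
`Summit.Ventures.HSemireg.WedgeBox`; this family's Fin-indexed `B K n s` is its own, kept apart from `Wedge.B` / `WedgePair.B` by namespace).
Part I/1: blocks, transversal pairs `P α β`, monomial basis, structure constants `sgn`, products with `E_P`.
-/

open Module Set Set.powersetCard

namespace Summit.Ventures.HSemireg.WedgeBox

variable (K : Type*) [Field K] (n : ℕ)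

/-- index type of the `4n` generators. -/
abbrev I : Type := Fin (n + n + n + n)

/-- the free module on the generators (`N_X ⊕ N_{X′}`). -/
abbrev N : Type _ := I n → K

/-- the exterior algebra (`HT^•(X × X′)` of the model, also the home of the classes). -/
abbrev HT : Type _ := ExteriorAlgebra K (N K n)

/-- standard basis. -/
noncomputable def b : Basis (I n) K (N K n) := Pi.basisFun K (I n)

/-- monomial basis of the exterior algebra. -/
noncomputable def B : Basis (Finset (I n)) K (HT K n) := (b K n).ExteriorAlgebra

/-- factor-1 blocks: `A 0 = X` (indices `< n`), `A 1 = Y` (indices in `[n, 2n)`). -/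
def A (α : Fin 2) : Finset (I n) :=
  Finset.univ.filter fun i => (α : ℕ) * n ≤ (i : ℕ) ∧ (i : ℕ) < ((α : ℕ) + 1) * n

/-- factor-2 blocks: `C 0 = X′` (indices in `[2n, 3n)`), `C 1 = Y′` (indices in `[3n, 4n)`). -/
def C (β : Fin 2) : Finset (I n) :=
  Finset.univ.filter fun i => ((β : ℕ) + 2) * n ≤ (i : ℕ) ∧ (i : ℕ) < ((β : ℕ) + 3) * n

/-- membership in the factor-1 block `A α`: indices in `[α·n, (α+1)·n)`. -/
lemma mem_A {α : Fin 2} {i : I n} : i ∈ A n α ↔ (α : ℕ) * n ≤ (i : ℕ) ∧ (i : ℕ) < ((α : ℕ) + 1) * n := by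
  simp [A]

/-- membership in the factor-2 block `C β`: indices in `[(β+2)·n, (β+3)·n)`. -/
lemma mem_C {β : Fin 2} {i : I n} : i ∈ C n β ↔ ((β : ℕ) + 2) * n ≤ (i : ℕ) ∧ (i : ℕ) < ((β : ℕ) + 3) * n := by
  simp [C]

/-- an interval block `[j n, (j+1) n)` has `n` elements. -/
lemma card_block (j : ℕ) (hj : j ≤ 3) :
    (Finset.univ.filter fun i : I n => j * n ≤ (i : ℕ) ∧ (i : ℕ) < (j + 1) * n).card = n := by
  have h : (Finset.univ.filter fun i : I n => j * n ≤ (i : ℕ) ∧ (i : ℕ) < (j + 1) * n) =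
      Finset.univ.map ⟨fun a : Fin n => (⟨j * n + a, by have := a.2; nlinarith⟩ : I n),
        fun a a' h => by exact Fin.ext (by simpa using h)⟩ := by
    ext i
    simp only [Finset.mem_filter, Finset.mem_univ, true_and, Finset.mem_map,
      Function.Embedding.coeFn_mk]
    constructor
    · rintro ⟨h1, h2⟩
      refine ⟨⟨(i : ℕ) - j * n, by rw [add_mul, one_mul] at h2; omega⟩, Fin.ext ?_⟩
      simp only; omega
    · rintro ⟨a, rfl⟩
      simp only
      have := a.2
      constructor
      · omega
      · nlinarith
  rw [h, Finset.card_map, Finset.card_univ, Fintype.card_fin]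

/-- `|A α| = n`. -/
lemma card_A (α : Fin 2) : (A n α).card = n := card_block n α (by have := α.2; omega)

/-- `|C β| = n`. -/
lemma card_C (β : Fin 2) : (C n β).card = n := card_block n (β + 2) (by have := β.2; omega)

/-! ### Block combinatorics -/

/-- distinct factor-1 blocks are disjoint. -/
lemma disjoint_A_A {α α' : Fin 2} (h : α ≠ α') : Disjoint (A n α) (A n α') := by
  rw [Finset.disjoint_left]
  intro i hi hi'
  rw [mem_A] at hi hi'
  have : (α : ℕ) ≠ (α' : ℕ) := fun e => h (Fin.ext e)
  rcases Nat.lt_or_gt_of_ne this with hlt | hlt <;> nlinarith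

/-- distinct factor-2 blocks are disjoint. -/
lemma disjoint_C_C {β β' : Fin 2} (h : β ≠ β') : Disjoint (C n β) (C n β') := by
  rw [Finset.disjoint_left]
  intro i hi hi'
  rw [mem_C] at hi hi'
  have : (β : ℕ) ≠ (β' : ℕ) := fun e => h (Fin.ext e)
  rcases Nat.lt_or_gt_of_ne this with hlt | hlt <;> nlinarith

/-- factor-1 and factor-2 blocks are disjoint. -/
lemma disjoint_A_C (α β : Fin 2) : Disjoint (A n α) (C n β) := by
  rw [Finset.disjoint_left]
  intro i hi hi'
  rw [mem_A] at hi
  rw [mem_C] at hi'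
  have hα := α.2
  nlinarith

/-- every generator lies in one of the four blocks. -/
lemma mem_cover (i : I n) : (∃ α, i ∈ A n α) ∨ (∃ β, i ∈ C n β) := by
  have hi := i.2
  by_cases h0 : (i : ℕ) < n
  · exact Or.inl ⟨0, by rw [mem_A]; simp; omega⟩
  by_cases h1 : (i : ℕ) < n + n
  · exact Or.inl ⟨1, by rw [mem_A]; simp; omega⟩
  by_cases h2 : (i : ℕ) < n + n + n
  · exact Or.inr ⟨0, by rw [mem_C]; simp; omega⟩
  · exact Or.inr ⟨1, by rw [mem_C]; simp; omega⟩

/-- the «transversal pair» supports `P α β = A_α ∪ C_β`. -/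
def P (α β : Fin 2) : Finset (I n) := A n α ∪ C n β

/-- `|P α β| = 2n`. -/
lemma card_P (α β : Fin 2) : (P n α β).card = n + n := by
  rw [P, Finset.card_union_of_disjoint (disjoint_A_C n α β), card_A, card_C]

/-- `P α β` as an element of `powersetCard`. -/
def Ppc (α β : Fin 2) : powersetCard (I n) (n + n) := ⟨P n α β, by rw [mem_iff, card_P]⟩

/-- coercion of `Ppc α β` is `P α β`. -/
@[simp] lemma coe_Ppc (α β : Fin 2) : ((Ppc n α β : powersetCard (I n) (n + n)) : Finset (I n)) = P n α β :=
  rfl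

/-- `s` is disjoint from `P α β` iff it is disjoint from both blocks. -/
lemma disjoint_P_iff {s : Finset (I n)} {α β : Fin 2} :
    Disjoint s (P n α β) ↔ Disjoint s (A n α) ∧ Disjoint s (C n β) := by
  rw [P, Finset.disjoint_union_right]

/-! ### The box class, the wedge map and its range -/

/-- the box class `Σ c_{αβ} E_{A_α ∪ C_β}`. -/
noncomputable def boxClass (c : Fin 2 → Fin 2 → K) : HT K n :=
  ∑ α, ∑ β, c α β • B K n (Ppc n α β : powersetCard (I n) (n + n))

/-- `θ ↦ θ ∧ v` on `⋀^k`. -/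
noncomputable def wedgeMap (k : ℕ) (v : HT K n) : (⋀[K]^k (N K n)) →ₗ[K] HT K n :=
  (LinearMap.mulRight K v) ∘ₗ (⋀[K]^k (N K n)).subtype

/-- `⋀^k` is the span of the monomials of cardinality `k`. -/
lemma exteriorPower_eq_span (k : ℕ) :
    (⋀[K]^k (N K n) : Submodule K (HT K n)) =
      Submodule.span K (Set.range fun s : powersetCard (I n) k => (B K n s : HT K n)) := by
  have h1 : (⋀[K]^k (N K n) : Submodule K (HT K n)) =
      Submodule.map (⋀[K]^k (N K n)).subtype ⊤ := by simp
  rw [h1, ← ((b K n).exteriorPower k).span_eq, Submodule.map_span, ← Set.range_comp]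
  congr 1
  ext s
  simp [B, ExteriorAlgebra.basis_eq_coe_basis]

/-- the range of `θ ↦ θ ∧ v` on `⋀^k` is spanned by the `E_s ∧ v`, `|s| = k`. -/
lemma range_wedgeMap (k : ℕ) (v : HT K n) :
    LinearMap.range (wedgeMap K n k v) =
      Submodule.span K (Set.range fun s : powersetCard (I n) k => (B K n s : HT K n) * v) := by
  rw [wedgeMap, LinearMap.range_comp, Submodule.range_subtype, exteriorPower_eq_span,
    Submodule.map_span, ← Set.range_comp]
  rfl

variable {n}

/-- the monomial `B s` as Mathlib's basis vector at `pc s`. -/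
lemma B_apply_pc {k : ℕ} (s : powersetCard (I n) k) :
    B K n s = (b K n).ExteriorAlgebra (s : Finset (I n)) := rfl

/-- a monomial of cardinality `k` lies in `⋀^k`. -/
lemma B_mem_exteriorPower {k : ℕ} (s : powersetCard (I n) k) :
    (B K n s : HT K n) ∈ ⋀[K]^k (N K n) := by
  rw [B_apply_pc, ExteriorAlgebra.basis_eq_coe_basis]; exact Submodule.coe_mem _

/-- `wedgeMap k v θ = θ * v`. -/
lemma wedgeMap_apply {k : ℕ} (v : HT K n) (x : ⋀[K]^k (N K n)) :
    wedgeMap K n k v x = (x : HT K n) * v := rfl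

/-- the sign of the product of two monomials, as a scalar of `K` (`0` if they are not disjoint). -/
noncomputable def sgn {k m : ℕ} (s : powersetCard (I n) k) (t : powersetCard (I n) m) : K :=
  if h : Disjoint s.val t.val then (((permOfDisjoint h).sign : ℤ) : K) else 0

/-- the structure constant of disjoint monomials is the (unit) permutation sign. -/
lemma sgn_of_disjoint {k m : ℕ} {s : powersetCard (I n) k} {t : powersetCard (I n) m}
    (h : Disjoint s.val t.val) : sgn K s t = (((permOfDisjoint h).sign : ℤ) : K) := by
  rw [sgn, dif_pos h]

/-- the structure constant of overlapping monomials is `0`. -/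
lemma sgn_of_not_disjoint {k m : ℕ} {s : powersetCard (I n) k} {t : powersetCard (I n) m}
    (h : ¬ Disjoint s.val t.val) : sgn K s t = 0 := by
  rw [sgn, dif_neg h]

/-- the structure constant is non-zero iff the supports are disjoint. -/
lemma sgn_ne_zero_iff {k m : ℕ} {s : powersetCard (I n) k} {t : powersetCard (I n) m} :
    sgn K s t ≠ 0 ↔ Disjoint s.val t.val := by
  constructor
  · intro h
    by_contra hd
    exact h (sgn_of_not_disjoint K hd)
  · intro hd
    rw [sgn_of_disjoint K hd]
    -- a ±1 of ℤ is non-zero in the field K (p4's landed `ContractionSpan.intUnits_cast_ne_zero`, inlined)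
    intro h
    have h2 : (((permOfDisjoint hd).sign : ℤ) : K) * (((permOfDisjoint hd).sign : ℤ) : K) = 1 := by
      rw [← Int.cast_mul, ← Units.val_mul, Int.units_mul_self, Units.val_one, Int.cast_one]
    rw [h, mul_zero] at h2
    exact zero_ne_one h2

/-- product of two monomials in scalar form. -/
lemma B_mul_B {k m : ℕ} (s : powersetCard (I n) k) (t : powersetCard (I n) m) :
    B K n s * B K n t = sgn K s t • B K n (s.val ∪ t.val) := by
  by_cases h : Disjoint s.val t.val
  · rw [B_apply_pc, B_apply_pc, ExteriorAlgebra.basis_mul_of_disjoint (b K n) s t h, sgn_of_disjoint K h,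
      Units.smul_def, ← Int.cast_smul_eq_zsmul K, coe_disjUnion, Finset.disjUnion_eq_union]
    rfl
  · rw [B_apply_pc, B_apply_pc, ExteriorAlgebra.basis_mul_of_not_disjoint (b K n) s t h,
      sgn_of_not_disjoint K h, zero_smul]

/-- product of a monomial with the transversal-pair monomial `E_{P α β}`. -/
lemma B_mul_BP {k : ℕ} (s : powersetCard (I n) k) (α β : Fin 2) :
    B K n s * B K n (P n α β) = sgn K s (Ppc n α β) • B K n (s.val ∪ P n α β) :=
  B_mul_B K s (Ppc n α β)

/-- image of a monomial under `θ ↦ θ ∧ boxClass`. -/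
lemma B_mul_boxClass {k : ℕ} (c : Fin 2 → Fin 2 → K) (s : powersetCard (I n) k) :
    B K n s * boxClass K n c =
      ∑ α, ∑ β, (c α β * sgn K s (Ppc n α β)) • B K n (s.val ∪ P n α β) := by
  simp only [boxClass, Finset.mul_sum, mul_smul_comm, coe_Ppc, B_mul_BP, smul_smul]

/-- coordinates of that image. -/
lemma coord_B_mul_boxClass {k : ℕ} (c : Fin 2 → Fin 2 → K) (s : powersetCard (I n) k)
    (m : Finset (I n)) :
    (B K n).coord m (B K n s * boxClass K n c) =
      ∑ α, ∑ β, c α β * sgn K s (Ppc n α β) * (if s.val ∪ P n α β = m then 1 else 0) := by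
  classical
  rw [B_mul_boxClass]
  simp only [map_sum, map_smul, Basis.coord_apply, Basis.repr_self, smul_eq_mul]
  refine Finset.sum_congr rfl fun α _ => Finset.sum_congr rfl fun β _ => ?_
  rw [Finsupp.single_apply]

/-! ### The key injectivity: from `s ∪ P` one recovers `s` and `P` (when `card s < n`). -/

/-- if `A α ⊆ s ∪ P α' β'` with `α ≠ α'` then `A α ⊆ s`. -/
lemma A_subset_of_subset_union {α α' β' : Fin 2} {s : Finset (I n)} (hα : α ≠ α')
    (h : A n α ⊆ s ∪ P n α' β') : A n α ⊆ s := by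
  intro i hi
  have := h hi
  rw [Finset.mem_union, P, Finset.mem_union] at this
  rcases this with h1 | h2 | h3
  · exact h1
  · exact ((Finset.disjoint_left.mp (disjoint_A_A n hα)) hi h2).elim
  · exact ((Finset.disjoint_left.mp (disjoint_A_C n α β')) hi h3).elim

/-- if `C β ⊆ s ∪ P α' β'` with `β ≠ β'` then `C β ⊆ s`. -/
lemma C_subset_of_subset_union {β α' β' : Fin 2} {s : Finset (I n)} (hβ : β ≠ β')
    (h : C n β ⊆ s ∪ P n α' β') : C n β ⊆ s := by
  intro i hi
  have := h hi
  rw [Finset.mem_union, P, Finset.mem_union] at this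
  rcases this with h1 | h2 | h3
  · exact h1
  · exact ((Finset.disjoint_left.mp (disjoint_A_C n α' β)) h2 hi).elim
  · exact ((Finset.disjoint_left.mp (disjoint_C_C n hβ)) hi h3).elim

/-- KEY: if `card s < n`, `s` disjoint from `P α β`, `s'` disjoint from `P α' β'` and
`s' ∪ P α' β' = s ∪ P α β`, then `α' = α`, `β' = β` and `s' = s`. -/
lemma key {s s' : Finset (I n)} {α β α' β' : Fin 2} (hs : s.card < n)
    (hd : Disjoint s (P n α β)) (hd' : Disjoint s' (P n α' β')) (h : s' ∪ P n α' β' = s ∪ P n α β) :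
    α' = α ∧ β' = β ∧ s' = s := by
  have hα : α' = α := by
    by_contra hne
    have hsub : A n α' ⊆ s ∪ P n α β := by
      rw [← h]; intro i hi; exact Finset.mem_union_right _ (by rw [P]; exact Finset.mem_union_left _ hi)
    have := Finset.card_le_card (A_subset_of_subset_union hne hsub)
    rw [card_A] at this
    omega
  have hβ : β' = β := by
    by_contra hne
    have hsub : C n β' ⊆ s ∪ P n α β := by
      rw [← h]; intro i hi; exact Finset.mem_union_right _ (by rw [P]; exact Finset.mem_union_right _ hi)
    have := Finset.card_le_card (C_subset_of_subset_union hne hsub)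
    rw [card_C] at this
    omega
  subst hα hβ
  refine ⟨rfl, rfl, ?_⟩
  rw [← Finset.union_sdiff_cancel_right hd', h, Finset.union_sdiff_cancel_right hd]

/-! ### The relevant monomials: pure (inside one block) and mixed (inside `A_α ∪ C_β`, meeting both). -/

/-- the other element of `Fin 2`. -/
def other (α : Fin 2) : Fin 2 := if α = 0 then 1 else 0

/-- `other α ≠ α`. -/
lemma other_ne (α : Fin 2) : other α ≠ α := by
  unfold other; split_ifs with h <;> omega

/-- the element of `Fin 2` different from `α` is `other α`. -/
lemma eq_other_of_ne {α α' : Fin 2} (h : α' ≠ α) : α' = other α := by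
  unfold other; split_ifs with h0 <;> omega

end Summit.Ventures.HSemireg.WedgeBox
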